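import Literature.Geometry.Kaehler.TorusDolbeaultRegularityLocal
import Literature.Geometry.Kaehler.TorusDolbeaultLocalData
import Literature.Geometry.Kaehler.TorusDolbeaultAgreement
import HarnessLib

/-!
# Local regularity of weak solutions of `Δ_∂̄` (Warner 6.32 for the `∂̄`-Laplacian, local form)

Instantiation of the abstract local representation theorem `exists_local_repr` for
`Δ = Δ_∂̄ = ∂̄∂̄* + ∂̄*∂̄` on complex `K`-forms of a compact Hermitian manifold, in the three degree
cases (generic, `0`, top): around every point `p` there is an open neighbourhood `U` and a smooth
form `u` with `ℓ(φ) = ⟪u, φ⟫` for all smooth `φ` supported in `U`, whenever `ℓ` is a bounded weak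
solution `ℓ(Δφ) = ⟪α, φ⟫`.

## References

* F. W. Warner, GTM 94 (1983), 6.32, 6.5. [WarnerGTM94]
-/

noncomputable section

open scoped Manifold ContDiff Topology NNReal ENNReal ComplexConjugate ComplexInnerProductSpace
open Bundle Set Function Module Metric Complex Filter MeasureTheory UnitAddTorus
open Literature.Analysis.FunctionSpaces Literature.Analysis.FunctionSpaces.Torus Literature.NumberTheory.Transcendental

set_option maxSynthPendingDepth 2

namespace Literature.Geometry.Kaehler

variable {E : Type*} [NormedAddCommGroup E] [NormedSpace ℂ E] [FiniteDimensional ℂ E]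
  {n : ℕ} [Fact (finrank ℝ E = n)] [MeasurableSpace E] [BorelSpace E]
  {M : Type*} [TopologicalSpace M] [ChartedSpace E M] [T2Space M] [CompactSpace M]
  [IsManifold 𝓘(ℂ, E) ω M] [IsManifold 𝓘(ℝ, E) ∞ M] [RiemannianBundle (fun x : M ↦ TangentSpace 𝓘(ℝ, E) x)]
  [IsContMDiffRiemannianBundle 𝓘(ℝ, E) ∞ E (fun x : M ↦ TangentSpace 𝓘(ℝ, E) x)]
  (o : (x : M) → Orientation ℝ (TangentSpace 𝓘(ℝ, E) x) (Fin n)) {k m : ℕ}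
  [Fact (IsSmoothForm (riemannianVolumeForm o))]

omit [FiniteDimensional ℂ E] [Fact (finrank ℝ E = n)] [MeasurableSpace E] [BorelSpace E] [T2Space M] [CompactSpace M]
  [IsManifold 𝓘(ℂ, E) ω M] [IsManifold 𝓘(ℝ, E) ∞ M] [RiemannianBundle (fun x : M ↦ TangentSpace 𝓘(ℝ, E) x)]
  [IsContMDiffRiemannianBundle 𝓘(ℝ, E) ∞ E (fun x : M ↦ TangentSpace 𝓘(ℝ, E) x)] in
/-- The open neighbourhood `U_p = source ∩ chart⁻¹ Φ⁻¹(ball c₀ (ρ/8))` of the local step. [folklore] -/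
theorem exists_open_small_cube_nhds {p : M} {A : E ≃L[ℝ] EuclideanSpace ℝ (Fin n)} (𝒞 : CubeCutoff p A) :
    ∃ U : Set M, IsOpen U ∧ p ∈ U ∧ ∀ x ∈ U, x ∈ (extChartAt 𝓘(ℝ, E) p).source ∧
      extChartAt 𝓘(ℝ, E) p x ∈ cubeRegion A (extChartAt 𝓘(ℝ, E) p p) (𝒞.ρ / 8) := by
  refine ⟨(extChartAt 𝓘(ℝ, E) p).source ∩ extChartAt 𝓘(ℝ, E) p ⁻¹'
      {y | cubeMap A (extChartAt 𝓘(ℝ, E) p p) y ∈ ball (Torus.cubeCenter (Fin n)) (𝒞.ρ / 8)}, ?_, ?_, ?_⟩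
  · exact (continuousOn_extChartAt p).isOpen_inter_preimage (isOpen_extChartAt_source p)
      (isOpen_ball.preimage (cubeMap A _).continuous)
  · refine ⟨mem_extChartAt_source p, ?_⟩
    simp only [Set.mem_preimage, mem_setOf_eq, cubeMap_self]
    exact mem_ball_self (by linarith [𝒞.ρ_pos])
  · exact fun x hx ↦ ⟨hx.1, ball_subset_closedBall hx.2⟩

/-- **Local regularity for `Δ_∂̄`, generic degree** (`(k+1) + (m+1) = n`): a bounded weak solution
`ℓ(Δ_∂̄ φ) = ⟪α, φ⟫` is locally represented by a smooth form. [cite: WarnerGTM94, 6.32] -/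
theorem CL2SmoothForms.exists_local_repr_dolbeault
    (hH : ∀ (x : M) (v w : TangentSpace 𝓘(ℝ, E) x), inner ℝ (tangentJ E x v) (tangentJ E x w) = inner ℝ v w)
    (h : (k + 1) + (m + 1) = n) (p : M) (α : CL2SmoothForms o (k + 1)) (ℓ : CL2SmoothForms o (k + 1) →L[ℂ] ℂ)
    (hweak : ∀ φ, ℓ (CL2SmoothForms.dolbeaultLaplacian o h φ) = ⟪α, φ⟫) :
    ∃ U : Set M, IsOpen U ∧ p ∈ U ∧ ∃ (u : MForm 𝓘(ℝ, E) M ℂ (k + 1)) (hu : IsSmoothForm u),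
      ∀ (t : MForm 𝓘(ℝ, E) M ℂ (k + 1)) (ht : IsSmoothForm t), (∀ x, t x ≠ 0 → x ∈ U) →
        ℓ (CL2SmoothForms.mk o t ht) = ⟪CL2SmoothForms.mk o u hu, CL2SmoothForms.mk o t ht⟫ := by
  have ho : IsSmoothForm (riemannianVolumeForm o) := Fact.out
  haveI : IsContinuousRiemannianBundle E (fun x : M ↦ TangentSpace 𝓘(ℝ, E) x) :=
    isContinuousRiemannianBundle_of_isContMDiffRiemannianBundle 𝓘(ℝ, E) ∞
  have h₃ : (k + 1 + 1) + m = n := by omega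
  obtain ⟨A, 𝒞, κ, ε, εs, hκ, hell, hpert, hε, hsign⟩ := exists_goodDataAdj o ho hH h h₃ p
  obtain ⟨U, hU, hpU, hUK⟩ := exists_open_small_cube_nhds 𝒞
  have hΔsupp : ∀ {β : MForm 𝓘(ℝ, E) M ℂ (k + 1)} {r : ℝ}, IsSmoothForm β → r ≤ 𝒞.ρ →
      (∀ x, β x ≠ 0 → x ∈ (extChartAt 𝓘(ℝ, E) p).source ∧
        extChartAt 𝓘(ℝ, E) p x ∈ cubeRegion A (extChartAt 𝓘(ℝ, E) p p) r) →
      ∀ x, dolbeaultLaplacian o (k + 1) (m + 1) h β x ≠ 0 → x ∈ (extChartAt 𝓘(ℝ, E) p).source ∧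
        extChartAt 𝓘(ℝ, E) p x ∈ cubeRegion A (extChartAt 𝓘(ℝ, E) p p) r := by
    intro β r hβ hr hK x hx
    have hKt : cubeRegion A (extChartAt 𝓘(ℝ, E) p p) r ⊆ (extChartAt 𝓘(ℝ, E) p).target := cubeRegion_subset_target 𝒞 hr
    have h1 := ChartOp1.Represents.support_subset (fun p' ↦ represents_dolbeaultBarAdjoint o ho h p') hβ
      (isCompact_cubeRegion _) hKt hK
    have h2 := ChartOp1.Represents.support_subset (fun p' ↦ represents_dolbeaultBar (k := k) p')
      (IsSmoothForm.dolbeaultBarAdjoint o ho h hβ) (isCompact_cubeRegion _) hKt h1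
    have h3 := ChartOp1.Represents.support_subset (fun p' ↦ represents_dolbeaultBar (k := k + 1) p') hβ
      (isCompact_cubeRegion _) hKt hK
    have h4 := ChartOp1.Represents.support_subset (fun p' ↦ represents_dolbeaultBarAdjoint o ho h₃ p') hβ.dolbeaultBar
      (isCompact_cubeRegion _) hKt h3
    have hx' : dolbeaultBar (dolbeaultBarAdjoint o h β) x + dolbeaultBarAdjoint o h₃ (dolbeaultBar β) x ≠ 0 := hx
    by_cases ha : dolbeaultBar (dolbeaultBarAdjoint o h β) x = 0
    · rw [ha, zero_add] at hx'; exact h4 x hx'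
    · exact h2 x ha
  obtain ⟨u, hu, hrep⟩ := exists_local_repr o (fibreIso E (k + 1)) 𝒞 hsign (dolbeaultLaplacian o (k + 1) (m + 1) h)
    (fun hβ ↦ IsSmoothForm.dolbeaultLaplacian o ho h hβ) hΔsupp (CL2SmoothForms.dolbeaultLaplacian o h)
    (CL2SmoothForms.toForm_dolbeaultLaplacian o h) (torusLaplacian o ho h h₃ 𝒞) (torusLaplacianAdj o ho h h₃ 𝒞)
    (fun hβ hK ↦ mFourierCoeff_toTorus_dolbeaultLaplacian o ho h 𝒞 hβ hK)
    (fun hu hv ↦ Lattice.pairing_laplaceLikeAdj_apply_left _ _ _ _ hu hv) hκ hell hpert hε α ℓ hweak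
  exact ⟨U, hU, hpU, u, hu, fun t ht htU ↦ hrep t ht fun x hx ↦ hUK x (htU x hx)⟩

/-- **Local regularity for `Δ_∂̄`, degree `0`** (`0 + (m+1) = n`, `Δ_∂̄ = ∂̄*∂̄`). [cite: WarnerGTM94, 6.32] -/
theorem CL2SmoothForms.exists_local_repr_dolbeault_zero
    (hH : ∀ (x : M) (v w : TangentSpace 𝓘(ℝ, E) x), inner ℝ (tangentJ E x v) (tangentJ E x w) = inner ℝ v w)
    (h : 0 + (m + 1) = n) (p : M) (α : CL2SmoothForms o 0) (ℓ : CL2SmoothForms o 0 →L[ℂ] ℂ)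
    (hweak : ∀ φ, ℓ (CL2SmoothForms.dolbeaultLaplacian o h φ) = ⟪α, φ⟫) :
    ∃ U : Set M, IsOpen U ∧ p ∈ U ∧ ∃ (u : MForm 𝓘(ℝ, E) M ℂ 0) (hu : IsSmoothForm u),
      ∀ (t : MForm 𝓘(ℝ, E) M ℂ 0) (ht : IsSmoothForm t), (∀ x, t x ≠ 0 → x ∈ U) →
        ℓ (CL2SmoothForms.mk o t ht) = ⟪CL2SmoothForms.mk o u hu, CL2SmoothForms.mk o t ht⟫ := by
  have ho : IsSmoothForm (riemannianVolumeForm o) := Fact.out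
  haveI : IsContinuousRiemannianBundle E (fun x : M ↦ TangentSpace 𝓘(ℝ, E) x) :=
    isContinuousRiemannianBundle_of_isContMDiffRiemannianBundle 𝓘(ℝ, E) ∞
  have h₃ : (0 + 1) + m = n := by omega
  obtain ⟨A, 𝒞, κ, ε, εs, hκ, hell, hpert, hε, hsign⟩ := exists_goodDataZeroAdj o ho hH h₃ p
  obtain ⟨U, hU, hpU, hUK⟩ := exists_open_small_cube_nhds 𝒞
  have hΔsupp : ∀ {β : MForm 𝓘(ℝ, E) M ℂ 0} {r : ℝ}, IsSmoothForm β → r ≤ 𝒞.ρ →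
      (∀ x, β x ≠ 0 → x ∈ (extChartAt 𝓘(ℝ, E) p).source ∧
        extChartAt 𝓘(ℝ, E) p x ∈ cubeRegion A (extChartAt 𝓘(ℝ, E) p p) r) →
      ∀ x, dolbeaultLaplacian o 0 (m + 1) h β x ≠ 0 → x ∈ (extChartAt 𝓘(ℝ, E) p).source ∧
        extChartAt 𝓘(ℝ, E) p x ∈ cubeRegion A (extChartAt 𝓘(ℝ, E) p p) r := by
    intro β r hβ hr hK
    have hKt : cubeRegion A (extChartAt 𝓘(ℝ, E) p p) r ⊆ (extChartAt 𝓘(ℝ, E) p).target := cubeRegion_subset_target 𝒞 hr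
    have h3 := ChartOp1.Represents.support_subset (fun p' ↦ represents_dolbeaultBar (k := 0) p') hβ
      (isCompact_cubeRegion _) hKt hK
    exact ChartOp1.Represents.support_subset (fun p' ↦ represents_dolbeaultBarAdjoint o ho h₃ p') hβ.dolbeaultBar
      (isCompact_cubeRegion _) hKt h3
  obtain ⟨u, hu, hrep⟩ := exists_local_repr o (fibreIso E 0) 𝒞 hsign (dolbeaultLaplacian o 0 (m + 1) h)
    (fun hβ ↦ IsSmoothForm.dolbeaultLaplacian o ho h hβ) hΔsupp (CL2SmoothForms.dolbeaultLaplacian o h)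
    (CL2SmoothForms.toForm_dolbeaultLaplacian o h) (torusLaplacianZero o ho h₃ 𝒞) (torusLaplacianZeroAdj o ho h₃ 𝒞)
    (fun hβ hK ↦ mFourierCoeff_toTorus_dolbeaultLaplacian_zero o ho h 𝒞 hβ hK)
    (fun hu hv ↦ Lattice.pairing_compAdj_apply_left _ _ hu hv) hκ hell hpert hε α ℓ hweak
  exact ⟨U, hU, hpU, u, hu, fun t ht htU ↦ hrep t ht fun x hx ↦ hUK x (htU x hx)⟩

/-- **Local regularity for `Δ_∂̄`, top degree** (`(k+1) + 0 = n`, `Δ_∂̄ = ∂̄∂̄*`). [cite: WarnerGTM94, 6.32] -/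
theorem CL2SmoothForms.exists_local_repr_dolbeault_top
    (hH : ∀ (x : M) (v w : TangentSpace 𝓘(ℝ, E) x), inner ℝ (tangentJ E x v) (tangentJ E x w) = inner ℝ v w)
    (h : (k + 1) + 0 = n) (p : M) (α : CL2SmoothForms o (k + 1)) (ℓ : CL2SmoothForms o (k + 1) →L[ℂ] ℂ)
    (hweak : ∀ φ, ℓ (CL2SmoothForms.dolbeaultLaplacian o h φ) = ⟪α, φ⟫) :
    ∃ U : Set M, IsOpen U ∧ p ∈ U ∧ ∃ (u : MForm 𝓘(ℝ, E) M ℂ (k + 1)) (hu : IsSmoothForm u),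
      ∀ (t : MForm 𝓘(ℝ, E) M ℂ (k + 1)) (ht : IsSmoothForm t), (∀ x, t x ≠ 0 → x ∈ U) →
        ℓ (CL2SmoothForms.mk o t ht) = ⟪CL2SmoothForms.mk o u hu, CL2SmoothForms.mk o t ht⟫ := by
  have ho : IsSmoothForm (riemannianVolumeForm o) := Fact.out
  haveI : IsContinuousRiemannianBundle E (fun x : M ↦ TangentSpace 𝓘(ℝ, E) x) :=
    isContinuousRiemannianBundle_of_isContMDiffRiemannianBundle 𝓘(ℝ, E) ∞
  obtain ⟨A, 𝒞, κ, ε, εs, hκ, hell, hpert, hε, hsign⟩ := exists_goodDataTopAdj o ho hH h p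
  obtain ⟨U, hU, hpU, hUK⟩ := exists_open_small_cube_nhds 𝒞
  have hΔsupp : ∀ {β : MForm 𝓘(ℝ, E) M ℂ (k + 1)} {r : ℝ}, IsSmoothForm β → r ≤ 𝒞.ρ →
      (∀ x, β x ≠ 0 → x ∈ (extChartAt 𝓘(ℝ, E) p).source ∧
        extChartAt 𝓘(ℝ, E) p x ∈ cubeRegion A (extChartAt 𝓘(ℝ, E) p p) r) →
      ∀ x, dolbeaultLaplacian o (k + 1) 0 h β x ≠ 0 → x ∈ (extChartAt 𝓘(ℝ, E) p).source ∧
        extChartAt 𝓘(ℝ, E) p x ∈ cubeRegion A (extChartAt 𝓘(ℝ, E) p p) r := by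
    intro β r hβ hr hK
    have hKt : cubeRegion A (extChartAt 𝓘(ℝ, E) p p) r ⊆ (extChartAt 𝓘(ℝ, E) p).target := cubeRegion_subset_target 𝒞 hr
    have h1 := ChartOp1.Represents.support_subset (fun p' ↦ represents_dolbeaultBarAdjoint o ho h p') hβ
      (isCompact_cubeRegion _) hKt hK
    exact ChartOp1.Represents.support_subset (fun p' ↦ represents_dolbeaultBar (k := k) p')
      (IsSmoothForm.dolbeaultBarAdjoint o ho h hβ) (isCompact_cubeRegion _) hKt h1
  obtain ⟨u, hu, hrep⟩ := exists_local_repr o (fibreIso E (k + 1)) 𝒞 hsign (dolbeaultLaplacian o (k + 1) 0 h)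
    (fun hβ ↦ IsSmoothForm.dolbeaultLaplacian o ho h hβ) hΔsupp (CL2SmoothForms.dolbeaultLaplacian o h)
    (CL2SmoothForms.toForm_dolbeaultLaplacian o h) (torusLaplacianTop o ho h 𝒞) (torusLaplacianTopAdj o ho h 𝒞)
    (fun hβ hK ↦ mFourierCoeff_toTorus_dolbeaultLaplacian_top o ho h 𝒞 hβ hK)
    (fun hu hv ↦ Lattice.pairing_compAdj_apply_left _ _ hu hv) hκ hell hpert hε α ℓ hweak
  exact ⟨U, hU, hpU, u, hu, fun t ht htU ↦ hrep t ht fun x hx ↦ hUK x (htU x hx)⟩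

end Literature.Geometry.Kaehler
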